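import Mathlib.LinearAlgebra.Isomorphisms
import Literature.NumberTheory.Automorphic.LocalConstants
import Literature.NumberTheory.GaloisRepresentations.LocalClassFieldTheoryGL1Proofs
import Literature.NumberTheory.GaloisRepresentations.WeilGroupProofs
import HarnessLib

/-!
# Uniqueness of the local constants: reductions from Deligne's axioms

Topic `Literature/NumberTheory/Automorphic` (AutomorphicL prelude I19, companion of
`LocalConstants`).  Deligne (*Les constantes des équations fonctionnelles des fonctions L*,
Antwerp II, LNM 349 (1973), Thm. 4.1) proves that the system of local constants
`ε₀(ρ, ψ, dx)` is **unique**: it is determined by (1) multiplicativity in short exact sequences,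
(2) the one-dimensional normalisation by Tate's local constant, (3) inductivity in degree `0`
(the named fact `Literature.NumberTheory.Automorphic.localEpsilonSystem_unique` of
`LocalConstants`, for two hypothesis structures `LocalEpsilonSystem F` with the same local Artin
data).  The printed proof: by (1) `ε` extends to virtual representations and it suffices to treat
irreducible `ρ`; an irreducible `ρ` is an unramified twist of a representation of a finite
Galois group, and by Brauer's theorem in degree `0`
(`Literature.RepresentationTheory.FiniteGroups.exists_sum_indClassFun_sub_one`) `ρ - dim ρ · 1`
is an integral combination of `Ind (χ - 1)`'s, on which `ε` is pinned by (2) and (3).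

This file proves, **from the axioms of `LocalEpsilonSystem` alone** (no named fact is used or
introduced), the formal reductions of that argument for two systems `𝓔`, `𝓔'`:

* `LocalEpsilonSystem.ε₀_eq_one_of_subsingleton` — `ε₀` of the zero representation is `1`
  (from (1) with `p = ⊤` and isomorphism invariance);
* `LocalEpsilonSystem.ε₀_ofSubrep_eq_of_eq`, `ε₀_toQuotient_eq_of_eq` — agreement of `𝓔`,
  `𝓔'` passes between `r`, `r|_p`, `r/p` (two out of three, by (1) and `ε₀ ≠ 0`): the
  "virtual representation" bookkeeping;
* `LocalEpsilonSystem.ε₀_eq_of_forall_isIrreducible` — **reduction to irreducibles**: if `𝓔` and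
  `𝓔'` agree on every irreducible `(ρ, 0)` then they agree everywhere (induction on `dim V`,
  using (1), `indep_N`, `equiv`);
* `LocalEpsilonSystem.ε₀_eq_of_isInducedFrom` — **transfer along induction in degree `0`**:
  agreement on `ρ'`, on `1_{E'}` and on some `ρ₁ ≅ Ind 1_{E'}` gives agreement on `ρ ≅ Ind ρ'`
  (axiom (3) for both systems and cancellation);
* `LocalEpsilonSystem.ε₀_ofQuasiChar_eq` — agreement in dimension one on `χ ∘ artin` whenever
  Tate's `ε(s, χ, ψ) = e q^{-as}` is witnessed (`HasTateEpsilon`), axiom (2);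
* `localEpsilonSystem_unique_of_forall_isIrreducible` — hence **`localEpsilonSystem_unique`
  follows from agreement on irreducible `(ρ, 0)`** for all finite extensions `E/F`.

What is NOT here (the remaining inputs of Deligne's proof, tracked in the provefact notes):
the structure of irreducible continuous representations of `W_E` (unramified twists of
Galois-type representations), the realisation of finite separable extensions of `E` as local
fields with `IsInducedFrom` along `WeilGroup.map`, and Tate's local functional equation
(`existsUnique_hasTateEpsilon`) supplying the `HasTateEpsilon` witnesses.

## Part II — direct sums and the one-dimensional case

* `WeilDeligneRep.prod r r'` — the direct sum `(ρ ⊕ ρ', N ⊕ N')` (Mathlib `Representation.prod`,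
  `LinearMap.prodMap`), with `prodOfSubrepEquiv : r ≅ (r ⊕ r')|_{V × 0}` and
  `prodToQuotientEquiv : (r ⊕ r')/(V × 0) ≅ r'`; hence `LocalEpsilonSystem.ε₀_prod`:
  **`ε₀(r ⊕ r') = ε₀(r) ε₀(r')`** (axiom (1) on the split sequence) — the tool for turning
  identities of virtual representations into identities of local constants.
* `WeilGroup.detChar`, `WeilGroup.detContinuousChar` — the character `det ∘ ρ : W_E → ℂˣ` of a
  one-dimensional representation, continuous for the Weil topology when `ρ` is
  (`WeilGroup.isTopologicalGroup_holds`); `WeilDeligneRep.exists_isEquivalent_ofQuasiChar` —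
  **a continuous one-dimensional `(ρ, 0)` is isomorphic to `(χ ∘ artin, 0)`** for a continuous
  quasi-character `χ` of `Eˣ` (local Langlands for `GL₁`, `LocalArtinData.recGL1_surjective` of
  `LocalClassFieldTheoryGL1Proofs`); hence `LocalEpsilonSystem.ε₀_eq_of_finrank_eq_one`: two
  systems with the same Artin data **agree on all one-dimensional representations of `W_E`**
  as soon as Tate's `ε(s, χ, ψ)` is witnessed for every `χ` (the content of the named fact
  `existsUnique_hasTateEpsilon`, taken here as the explicit hypothesis `hT`).

## Mathlib search

Mathlib (this pin) has `Representation.Equiv`, `Representation.prod`, `Submodule.topEquiv`,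
`LinearEquiv.ofSubsingleton`, `LinearMap.quotKerEquivOfSurjective`, `Submodule.finrank_lt`,
`Submodule.finrank_quotient_add_finrank`, `nonempty_linearEquiv_of_finrank_eq_one`,
`continuous_of_continuousAt_one`, used below; no local constants, no Weil groups.

## References

* P. Deligne, *Les constantes des équations fonctionnelles des fonctions L*, Modular Functions of
  One Variable II, LNM 349 (1973), 501–597, Thm. 4.1, §4 (`Deligne1973`).
* J. Tate, *Number theoretic background*, Corvallis 1979, (3.4.1)–(3.4.3) (`Corvallis1979`).
* C. Bushnell, G. Henniart, *The local Langlands conjecture for GL(2)* (2006), §29.4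
  (`BushnellHenniart2006`).
-/

noncomputable section

open scoped NNReal
open Module MeasureTheory

namespace Literature.NumberTheory.Automorphic

open Literature.NumberTheory.GaloisRepresentations (WeilDeligneRep)
open Literature.NumberTheory.GaloisRepresentations.WeilDeligneRep

/-! ### Two isomorphisms of Weil–Deligne representations -/

section WeilDeligneRep

variable {E : Type*} [Field E] [ValuativeRel E] [TopologicalSpace E] [IsNonarchimedeanLocalField E]
  {C : Type*} [Field C] [CharZero C] {V : Type*} [AddCommGroup V] [Module C V]
  {V' : Type*} [AddCommGroup V'] [Module C V']

/-- `⊤ ≤ V` is a sub-Weil–Deligne representation. Ref: Deligne, Antwerp II (1973), §8.4.1. [folklore] -/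
theorem _root_.Literature.NumberTheory.GaloisRepresentations.WeilDeligneRep.isSubrep_top
    (r : WeilDeligneRep E C V) : r.IsSubrep ⊤ :=
  ⟨fun _ _ _ => trivial, fun _ _ => trivial⟩

/-- The isomorphism `r|_⊤ ≅ r` (Mathlib `Submodule.topEquiv`).
Ref: Deligne, Antwerp II (1973), §8.4.1. [folklore] -/
def _root_.Literature.NumberTheory.GaloisRepresentations.WeilDeligneRep.ofSubrepTopEquiv
    (r : WeilDeligneRep E C V) : (r.ofSubrep ⊤ r.isSubrep_top).Equiv r where
  toRepEquiv := Representation.Equiv.mk Submodule.topEquiv fun g => by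
    ext ⟨v, hv⟩
    rfl
  comm_N := by
    ext ⟨v, hv⟩
    rfl

/-- Any two Weil–Deligne representations on zero spaces are isomorphic
(Mathlib `LinearEquiv.ofSubsingleton`). Ref: Deligne, Antwerp II (1973), §8.4.1. [folklore] -/
def _root_.Literature.NumberTheory.GaloisRepresentations.WeilDeligneRep.equivOfSubsingleton
    [Subsingleton V] [Subsingleton V'] (r : WeilDeligneRep E C V) (r' : WeilDeligneRep E C V') :
    r.Equiv r' where
  toRepEquiv := Representation.Equiv.mk (LinearEquiv.ofSubsingleton V V') fun g => by
    ext v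
    exact Subsingleton.elim _ _
  comm_N := by
    ext v
    exact Subsingleton.elim _ _

/-- Weil–Deligne representations on zero spaces are isomorphic (`IsEquivalent`).
Ref: Deligne, Antwerp II (1973), §8.4.1. [folklore] -/
theorem _root_.Literature.NumberTheory.GaloisRepresentations.WeilDeligneRep.isEquivalent_of_subsingleton
    [Subsingleton V] [Subsingleton V'] (r : WeilDeligneRep E C V) (r' : WeilDeligneRep E C V') :
    r.IsEquivalent r' :=
  ⟨r.equivOfSubsingleton r'⟩

/-- A Weil–Deligne representation on a non-zero space which is not irreducible has a proper
non-zero sub-Weil–Deligne representation (negation of `IsIrreducible`).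
Ref: Deligne, Antwerp II (1973), §8.4.1. [folklore] -/
theorem _root_.Literature.NumberTheory.GaloisRepresentations.WeilDeligneRep.exists_isSubrep_of_not_isIrreducible
    [Nontrivial V] {r : WeilDeligneRep E C V} (h : ¬ r.IsIrreducible) :
    ∃ p : Submodule C V, r.IsSubrep p ∧ p ≠ ⊥ ∧ p ≠ ⊤ := by
  by_contra hcon
  refine h ⟨inferInstance, fun p hp => ?_⟩
  by_contra hor
  exact hcon ⟨p, hp, fun h' => hor (Or.inl h'), fun h' => hor (Or.inr h')⟩

end WeilDeligneRep

/-! ### Consequences of the axioms for one system -/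

namespace LocalEpsilonSystem

variable {F : Type} [Field F] [ValuativeRel F] [TopologicalSpace F] [IsNonarchimedeanLocalField F]
variable {E : Type} [Field E] [ValuativeRel E] [TopologicalSpace E] [IsNonarchimedeanLocalField E]
  [Algebra F E] [FiniteDimensional F E] [MeasurableSpace E] [BorelSpace E]

/-- **`ε₀` of the zero representation is `1`** (Deligne 1973, Thm. 4.1 (1): `ε` is multiplicative
in short exact sequences, so `ε(0) = 1`).  From `mul_subrep` for `p = ⊤` — `ε₀ r = ε₀ (r|_⊤) ·
ε₀ (r/⊤)` with `r|_⊤ ≅ r` — one gets `ε₀ (r/⊤) = 1`, and a representation on a zero space is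
isomorphic to `r/⊤`. [cite: Deligne1973, Thm. 4.1] -/
theorem ε₀_eq_one_of_subsingleton (𝓔 : LocalEpsilonSystem F) {ψ : AddChar E Circle}
    (hψ : ψ.IsContinuousNontrivial) (μ : Measure E) [μ.IsAddHaarMeasure]
    {V : Type} [AddCommGroup V] [Module ℂ V] [FiniteDimensional ℂ V] [Subsingleton V]
    (r : GaloisRepresentations.WeilDeligneRep E ℂ V) : 𝓔.ε₀ E ψ μ r = 1 := by
  have hmul := 𝓔.mul_subrep E ψ μ r ⊤ r.isSubrep_top hψ
  rw [𝓔.equiv E ψ μ _ _ hψ ⟨r.ofSubrepTopEquiv⟩] at hmul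
  have hquot : 𝓔.ε₀ E ψ μ (r.toQuotient ⊤ r.isSubrep_top) = 1 :=
    (mul_eq_left₀ (𝓔.ne_zero E ψ μ r hψ)).mp hmul.symm
  haveI : Subsingleton (V ⧸ (⊤ : Submodule ℂ V)) := (Submodule.Quotient.subsingleton_iff).mpr rfl
  rw [← hquot]
  exact 𝓔.equiv E ψ μ _ _ hψ (r.isEquivalent_of_subsingleton _)

/-- `ε₀ (ρ, N) = ε₀ (ρ, 0)` (`indep_N` with `WeilDeligneRep.ofRep`; Deligne 1973, §8.12).
[cite: Deligne1973, §8.12] -/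
theorem ε₀_eq_ε₀_ofRep (𝓔 : LocalEpsilonSystem F) {ψ : AddChar E Circle}
    (hψ : ψ.IsContinuousNontrivial) (μ : Measure E) [μ.IsAddHaarMeasure]
    {V : Type} [AddCommGroup V] [Module ℂ V] [FiniteDimensional ℂ V]
    (r : GaloisRepresentations.WeilDeligneRep E ℂ V) :
    𝓔.ε₀ E ψ μ r = 𝓔.ε₀ E ψ μ (ofRep r.ρ r.isContinuous) :=
  𝓔.indep_N E ψ μ r _ hψ rfl

/-! ### Two systems: bookkeeping of agreement -/

variable (𝓔 𝓔' : LocalEpsilonSystem F)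

/-- **Two out of three, sub**: if `𝓔`, `𝓔'` agree on `r` and on `r/p` they agree on `r|_p`
(multiplicativity and `ε₀ ≠ 0`; the formal counterpart of passing to the virtual representation
`[r] - [r/p]`). [cite: Deligne1973, Thm. 4.1] -/
theorem ε₀_ofSubrep_eq_of_eq {ψ : AddChar E Circle} (hψ : ψ.IsContinuousNontrivial)
    (μ : Measure E) [μ.IsAddHaarMeasure]
    {V : Type} [AddCommGroup V] [Module ℂ V] [FiniteDimensional ℂ V]
    (r : GaloisRepresentations.WeilDeligneRep E ℂ V) (p : Submodule ℂ V) (hp : r.IsSubrep p)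
    (hr : 𝓔.ε₀ E ψ μ r = 𝓔'.ε₀ E ψ μ r)
    (hq : 𝓔.ε₀ E ψ μ (r.toQuotient p hp) = 𝓔'.ε₀ E ψ μ (r.toQuotient p hp)) :
    𝓔.ε₀ E ψ μ (r.ofSubrep p hp) = 𝓔'.ε₀ E ψ μ (r.ofSubrep p hp) := by
  have h := hr
  rw [𝓔.mul_subrep E ψ μ r p hp hψ, 𝓔'.mul_subrep E ψ μ r p hp hψ, hq] at h
  exact mul_right_cancel₀ (𝓔'.ne_zero E ψ μ _ hψ) h

/-- **Two out of three, quotient**: if `𝓔`, `𝓔'` agree on `r` and on `r|_p` they agree on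
`r/p`. [cite: Deligne1973, Thm. 4.1] -/
theorem ε₀_toQuotient_eq_of_eq {ψ : AddChar E Circle} (hψ : ψ.IsContinuousNontrivial)
    (μ : Measure E) [μ.IsAddHaarMeasure]
    {V : Type} [AddCommGroup V] [Module ℂ V] [FiniteDimensional ℂ V]
    (r : GaloisRepresentations.WeilDeligneRep E ℂ V) (p : Submodule ℂ V) (hp : r.IsSubrep p)
    (hr : 𝓔.ε₀ E ψ μ r = 𝓔'.ε₀ E ψ μ r)
    (hs : 𝓔.ε₀ E ψ μ (r.ofSubrep p hp) = 𝓔'.ε₀ E ψ μ (r.ofSubrep p hp)) :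
    𝓔.ε₀ E ψ μ (r.toQuotient p hp) = 𝓔'.ε₀ E ψ μ (r.toQuotient p hp) := by
  have h := hr
  rw [𝓔.mul_subrep E ψ μ r p hp hψ, 𝓔'.mul_subrep E ψ μ r p hp hψ, hs] at h
  exact mul_left_cancel₀ (𝓔'.ne_zero E ψ μ _ hψ) h

/-- **Multiplicativity**: if `𝓔`, `𝓔'` agree on `r|_p` and on `r/p` they agree on `r`.
[cite: Deligne1973, Thm. 4.1] -/
theorem ε₀_eq_of_ofSubrep_of_toQuotient {ψ : AddChar E Circle} (hψ : ψ.IsContinuousNontrivial)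
    (μ : Measure E) [μ.IsAddHaarMeasure]
    {V : Type} [AddCommGroup V] [Module ℂ V] [FiniteDimensional ℂ V]
    (r : GaloisRepresentations.WeilDeligneRep E ℂ V) (p : Submodule ℂ V) (hp : r.IsSubrep p)
    (hs : 𝓔.ε₀ E ψ μ (r.ofSubrep p hp) = 𝓔'.ε₀ E ψ μ (r.ofSubrep p hp))
    (hq : 𝓔.ε₀ E ψ μ (r.toQuotient p hp) = 𝓔'.ε₀ E ψ μ (r.toQuotient p hp)) :
    𝓔.ε₀ E ψ μ r = 𝓔'.ε₀ E ψ μ r := by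
  rw [𝓔.mul_subrep E ψ μ r p hp hψ, 𝓔'.mul_subrep E ψ μ r p hp hψ, hs, hq]

/-- **Reduction to irreducible representations** (Deligne 1973, proof of Thm. 4.1: by
additivity `ε` is defined on the Grothendieck group, generated by the irreducible `ρ`; and
`ε₀(ρ, N) = ε₀(ρ, 0)`).  If two systems agree on every irreducible Weil–Deligne representation
with `N = 0` of `W_E` (for the given `ψ`, `μ`), they agree on every Weil–Deligne representation
of `W_E`: induction on `dim V` via `indep_N`, a proper non-zero invariant subspace when `(ρ, 0)`
is reducible, `mul_subrep`, and `ε₀(0) = 1`. [cite: Deligne1973, Thm. 4.1] -/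
theorem ε₀_eq_of_forall_isIrreducible {ψ : AddChar E Circle} (hψ : ψ.IsContinuousNontrivial)
    (μ : Measure E) [μ.IsAddHaarMeasure]
    (H : ∀ {V : Type} [AddCommGroup V] [Module ℂ V] [FiniteDimensional ℂ V]
      (r : GaloisRepresentations.WeilDeligneRep E ℂ V), r.N = 0 → r.IsIrreducible →
        𝓔.ε₀ E ψ μ r = 𝓔'.ε₀ E ψ μ r)
    {V : Type} [AddCommGroup V] [Module ℂ V] [FiniteDimensional ℂ V]
    (r : GaloisRepresentations.WeilDeligneRep E ℂ V) : 𝓔.ε₀ E ψ μ r = 𝓔'.ε₀ E ψ μ r := by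
  suffices h : ∀ (n : ℕ) {V : Type} [AddCommGroup V] [Module ℂ V] [FiniteDimensional ℂ V]
      (r : GaloisRepresentations.WeilDeligneRep E ℂ V), finrank ℂ V ≤ n →
        𝓔.ε₀ E ψ μ r = 𝓔'.ε₀ E ψ μ r from h _ r le_rfl
  intro n
  induction n with
  | zero =>
    intro V _ _ _ r hV
    rcases subsingleton_or_nontrivial V with hV' | hV'
    · rw [𝓔.ε₀_eq_one_of_subsingleton hψ μ r, 𝓔'.ε₀_eq_one_of_subsingleton hψ μ r]
    · exact absurd hV (not_le.mpr finrank_pos)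
  | succ n ih =>
    intro V _ _ _ r hV
    -- replace `(ρ, N)` by `(ρ, 0)`
    rw [𝓔.ε₀_eq_ε₀_ofRep hψ μ r, 𝓔'.ε₀_eq_ε₀_ofRep hψ μ r]
    set r₀ := ofRep r.ρ r.isContinuous with hr₀
    rcases subsingleton_or_nontrivial V with hV' | hV'
    · rw [𝓔.ε₀_eq_one_of_subsingleton hψ μ r₀, 𝓔'.ε₀_eq_one_of_subsingleton hψ μ r₀]
    by_cases hirr : r₀.IsIrreducible
    · exact H r₀ rfl hirr
    · obtain ⟨p, hp, hpb, hpt⟩ := exists_isSubrep_of_not_isIrreducible hirr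
      have hlt₁ : finrank ℂ p < finrank ℂ V := Submodule.finrank_lt hpt
      have hlt₂ : finrank ℂ (V ⧸ p) < finrank ℂ V := by
        have h₁ := p.finrank_quotient_add_finrank
        have h₂ : finrank ℂ p ≠ 0 := fun h0 => hpb (Submodule.finrank_eq_zero.mp h0)
        omega
      exact 𝓔.ε₀_eq_of_ofSubrep_of_toQuotient 𝓔' hψ μ r₀ p hp
        (ih (r₀.ofSubrep p hp) (by omega)) (ih (r₀.toQuotient p hp) (by omega))

/-- **Transfer along induction in degree zero** (Deligne 1973, Thm. 4.1 (3), as the axiom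
`induction_degree_zero` of both systems): if `ρ ≅ Ind_{E'/E} ρ'`, `ρ₁ ≅ Ind_{E'/E} 1_{E'}`, and
`𝓔`, `𝓔'` agree on `ρ'` and on `1_{E'}` (over `E'`, for `ψ ∘ tr`) and on `ρ₁`, then they agree
on `ρ` — cancelling the non-zero factor `ε₀(1_{E'})^{dim ρ'}` (this needs `ψ ∘ tr_{E'/E}`
continuous and non-trivial, hypothesis `hψ'`). [cite: Deligne1973, Thm. 4.1] -/
theorem ε₀_eq_of_isInducedFrom
    (E' : Type) [Field E'] [ValuativeRel E'] [TopologicalSpace E'] [IsNonarchimedeanLocalField E']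
    [Algebra F E'] [FiniteDimensional F E'] [MeasurableSpace E'] [BorelSpace E'] [Algebra E E']
    [IsScalarTower F E E'] [FiniteDimensional E E'] [Algebra.IsSeparable E E']
    [ValuativeExtension E E']
    (h : (GaloisRepresentations.weilSubgroup E').map
      (GaloisRepresentations.absGaloisRestrict E E').toMonoidHom ≤ GaloisRepresentations.weilSubgroup E)
    {ψ : AddChar E Circle} (hψ : ψ.IsContinuousNontrivial)
    (hψ' : (ψ.compAddMonoidHom (Algebra.trace E E').toAddMonoidHom).IsContinuousNontrivial)
    (μ : Measure E) [μ.IsAddHaarMeasure] (μ' : Measure E') [μ'.IsAddHaarMeasure]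
    {V : Type} [AddCommGroup V] [Module ℂ V] [FiniteDimensional ℂ V]
    {V' : Type} [AddCommGroup V'] [Module ℂ V'] [FiniteDimensional ℂ V']
    {V₁ : Type} [AddCommGroup V₁] [Module ℂ V₁] [FiniteDimensional ℂ V₁]
    (r : GaloisRepresentations.WeilDeligneRep E ℂ V) (r' : GaloisRepresentations.WeilDeligneRep E' ℂ V')
    (r₁ : GaloisRepresentations.WeilDeligneRep E ℂ V₁)
    (hr : r.IsInducedFrom h r')
    (hr₁ : r₁.IsInducedFrom h (GaloisRepresentations.WeilDeligneRep.trivial ℂ ℂ :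
      GaloisRepresentations.WeilDeligneRep E' ℂ ℂ))
    (h' : 𝓔.ε₀ E' (ψ.compAddMonoidHom (Algebra.trace E E').toAddMonoidHom) μ' r' =
      𝓔'.ε₀ E' (ψ.compAddMonoidHom (Algebra.trace E E').toAddMonoidHom) μ' r')
    (h1 : 𝓔.ε₀ E' (ψ.compAddMonoidHom (Algebra.trace E E').toAddMonoidHom) μ'
        (GaloisRepresentations.WeilDeligneRep.trivial ℂ ℂ :
          GaloisRepresentations.WeilDeligneRep E' ℂ ℂ) =
      𝓔'.ε₀ E' (ψ.compAddMonoidHom (Algebra.trace E E').toAddMonoidHom) μ'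
        (GaloisRepresentations.WeilDeligneRep.trivial ℂ ℂ :
          GaloisRepresentations.WeilDeligneRep E' ℂ ℂ))
    (h₁ : 𝓔.ε₀ E ψ μ r₁ = 𝓔'.ε₀ E ψ μ r₁) :
    𝓔.ε₀ E ψ μ r = 𝓔'.ε₀ E ψ μ r := by
  have e₁ := 𝓔.induction_degree_zero E E' h ψ μ μ' r r' r₁ hψ hr hr₁
  have e₂ := 𝓔'.induction_degree_zero E E' h ψ μ μ' r r' r₁ hψ hr hr₁
  rw [h1, h', h₁, ← e₂] at e₁
  exact mul_right_cancel₀ (pow_ne_zero _ (𝓔'.ne_zero E' _ μ' _ hψ')) e₁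

/-- **Dimension one** (Deligne 1973, Thm. 4.1 (2), as the axiom `dim_one` of both systems): two
systems with the same local Artin data agree on `χ ∘ artin` as soon as Tate's
`ε(s, χ, ψ) = e · q^{-a s}` is witnessed for some Haar measure `μ'` on `Eˣ` (`HasTateEpsilon`;
Tate 1950, Thm. 2.4.1). [cite: Deligne1973, Thm. 4.1] -/
theorem ε₀_ofQuasiChar_eq (hart : 𝓔.artin = 𝓔'.artin)
    (hns : GaloisRepresentations.WeilGroup.exists_subgroup_le_inertia_isOpen_of_continuous (F := E))
    {ψ : AddChar E Circle} (hψ : ψ.IsContinuousNontrivial) (μ : Measure E) [μ.IsAddHaarMeasure]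
    (χ : QuasiChar E) (μ' : Measure Eˣ) [μ'.IsHaarMeasure] {e : ℂ} {a : ℤ}
    (he : HasTateEpsilon ψ μ μ' χ e a) :
    𝓔.ε₀ E ψ μ (GaloisRepresentations.WeilDeligneRep.ofQuasiChar hns (𝓔.artin E) χ) =
      𝓔'.ε₀ E ψ μ (GaloisRepresentations.WeilDeligneRep.ofQuasiChar hns (𝓔.artin E) χ) := by
  rw [𝓔.dim_one E hns ψ μ χ μ' e a hψ he, hart, 𝓔'.dim_one E hns ψ μ χ μ' e a hψ he]

end LocalEpsilonSystem

/-! ### The reduction of `localEpsilonSystem_unique` to irreducible representations -/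

section Unique

variable {F : Type} [Field F] [ValuativeRel F] [TopologicalSpace F] [IsNonarchimedeanLocalField F]

/-- **Uniqueness of the local constants reduces to irreducible representations** (Deligne 1973,
proof of Thm. 4.1, first step): if any two systems of local constants over `F` with the same
local Artin data agree on every *irreducible* Weil–Deligne representation `(ρ, 0)` of every
`W_E`, `E/F` finite (for all continuous non-trivial `ψ` and Haar `μ`), then
`localEpsilonSystem_unique` holds.  (The remaining content of Deligne's theorem is the agreement
on irreducibles: unramified twists of Galois-type representations, Brauer induction in degree
`0`, the one-dimensional case and inductivity.) [cite: Deligne1973, Thm. 4.1] -/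
theorem localEpsilonSystem_unique_of_forall_isIrreducible
    (H : ∀ (𝓔 𝓔' : LocalEpsilonSystem F), 𝓔.artin = 𝓔'.artin →
      ∀ (E : Type) [Field E] [ValuativeRel E] [TopologicalSpace E] [IsNonarchimedeanLocalField E]
        [Algebra F E] [FiniteDimensional F E] [MeasurableSpace E] [BorelSpace E]
        {V : Type} [AddCommGroup V] [Module ℂ V] [FiniteDimensional ℂ V]
        (ψ : AddChar E Circle) (μ : Measure E) [μ.IsAddHaarMeasure]
        (r : GaloisRepresentations.WeilDeligneRep E ℂ V),
        ψ.IsContinuousNontrivial → r.N = 0 → r.IsIrreducible → 𝓔.ε₀ E ψ μ r = 𝓔'.ε₀ E ψ μ r) :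
    localEpsilonSystem_unique (F := F) := by
  intro 𝓔 𝓔' hart E _ _ _ _ _ _ _ _ V _ _ _ ψ μ _ r hψ
  exact 𝓔.ε₀_eq_of_forall_isIrreducible 𝓔' hψ μ
    (fun r' hN hirr => H 𝓔 𝓔' hart E ψ μ r' hψ hN hirr) r

end Unique

/-! ## Part II — direct sums and the one-dimensional case -/

section PartII

open Literature.NumberTheory.GaloisRepresentations.WeilGroup Filter Topology

/-! ### Direct sums of Weil–Deligne representations -/

section Prod

variable {E : Type*} [Field E] [ValuativeRel E] [TopologicalSpace E] [IsNonarchimedeanLocalField E]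
  {C : Type*} [Field C] [CharZero C] {V : Type*} [AddCommGroup V] [Module C V]
  {V' : Type*} [AddCommGroup V'] [Module C V']

omit [CharZero C] in
/-- `(f × g)^k = f^k × g^k` for `LinearMap.prodMap` (kept in this file's namespace; a local
rewrite lemma, not a Mathlib extension). [folklore] -/
theorem linearMap_prodMap_pow (f : V →ₗ[C] V) (g : V' →ₗ[C] V') (k : ℕ) :
    (f.prodMap g) ^ k = (f ^ k).prodMap (g ^ k) := by
  induction k with
  | zero => rw [pow_zero, pow_zero, pow_zero, LinearMap.prodMap_one]
  | succ k ih => rw [pow_succ, pow_succ, pow_succ, ih, LinearMap.prodMap_mul]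

/-- The **direct sum** `(ρ ⊕ ρ', N ⊕ N')` of two Weil–Deligne representations, on `V × V'`
(Mathlib `Representation.prod`, `LinearMap.prodMap`).
Ref: Deligne, Antwerp II (1973), §8.4.1; Tate, Corvallis 1979, (4.1.2). [folklore] -/
def _root_.Literature.NumberTheory.GaloisRepresentations.WeilDeligneRep.prod
    (r : WeilDeligneRep E C V) (r' : WeilDeligneRep E C V') : WeilDeligneRep E C (V × V') where
  ρ := r.ρ.prod r'.ρ
  isContinuous := by
    obtain ⟨U, hU, hUo, hρ⟩ := r.isContinuous
    obtain ⟨U', -, hUo', hρ'⟩ := r'.isContinuous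
    refine ⟨U ⊓ U', inf_le_left.trans hU, hUo.inter hUo', fun u hu => ?_⟩
    change (r.ρ u).prodMap (r'.ρ u) = 1
    rw [hρ u hu.1, hρ' u hu.2, LinearMap.prodMap_one]
  N := r.N.prodMap r'.N
  isNilpotent_N := by
    obtain ⟨k, hk⟩ := r.isNilpotent_N
    obtain ⟨k', hk'⟩ := r'.isNilpotent_N
    refine ⟨k + k', ?_⟩
    rw [linearMap_prodMap_pow, pow_add, hk, zero_mul, pow_add, hk', mul_zero, LinearMap.prodMap_zero]
  conj_N w := by
    change (r.ρ w).prodMap (r'.ρ w) ∘ₗ r.N.prodMap r'.N = _ • (r.N.prodMap r'.N ∘ₗ (r.ρ w).prodMap (r'.ρ w))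
    rw [LinearMap.prodMap_comp, LinearMap.prodMap_comp, r.conj_N w, r'.conj_N w, LinearMap.prodMap_smul]

/-- The representation of `r.prod r'` at `w` is `ρ(w) × ρ'(w)`. [folklore] -/
@[simp] theorem _root_.Literature.NumberTheory.GaloisRepresentations.WeilDeligneRep.prod_ρ_apply
    (r : WeilDeligneRep E C V) (r' : WeilDeligneRep E C V') (w : GaloisRepresentations.WeilGroup E) :
    (r.prod r').ρ w = (r.ρ w).prodMap (r'.ρ w) := rfl

/-- The monodromy of `r.prod r'` is `N × N'`. [folklore] -/
@[simp] theorem _root_.Literature.NumberTheory.GaloisRepresentations.WeilDeligneRep.prod_N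
    (r : WeilDeligneRep E C V) (r' : WeilDeligneRep E C V') : (r.prod r').N = r.N.prodMap r'.N := rfl

/-- `V × 0 = ker(snd)` is a sub-Weil–Deligne representation of `r.prod r'`. [folklore] -/
theorem _root_.Literature.NumberTheory.GaloisRepresentations.WeilDeligneRep.isSubrep_prod_kerSnd
    (r : WeilDeligneRep E C V) (r' : WeilDeligneRep E C V') :
    (r.prod r').IsSubrep (LinearMap.ker (LinearMap.snd C V V')) := by
  refine ⟨fun w x hx => ?_, fun x hx => ?_⟩
  · have hx2 : x.2 = 0 := hx
    show (r.ρ w x.1, r'.ρ w x.2).2 = 0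
    rw [hx2, map_zero]
  · have hx2 : x.2 = 0 := hx
    show (r.N x.1, r'.N x.2).2 = 0
    rw [hx2, map_zero]

/-- Unfolding lemma: the quotient representation on a class. [folklore] -/
theorem _root_.Literature.NumberTheory.GaloisRepresentations.WeilDeligneRep.toQuotient_ρ_apply_mk
    (r : WeilDeligneRep E C V) (p : Submodule C V) (h : r.IsSubrep p)
    (w : GaloisRepresentations.WeilGroup E) (v : V) :
    (r.toQuotient p h).ρ w (Submodule.Quotient.mk v) = Submodule.Quotient.mk (r.ρ w v) := rfl

/-- Unfolding lemma: the quotient monodromy on a class. [folklore] -/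
theorem _root_.Literature.NumberTheory.GaloisRepresentations.WeilDeligneRep.toQuotient_N_apply_mk
    (r : WeilDeligneRep E C V) (p : Submodule C V) (h : r.IsSubrep p) (v : V) :
    (r.toQuotient p h).N (Submodule.Quotient.mk v) = Submodule.Quotient.mk (r.N v) := rfl

/-- `V ≅ V × 0 = ker(snd)` as `C`-modules. [folklore] -/
def kerSndEquiv (C V V' : Type*) [Field C] [AddCommGroup V] [Module C V] [AddCommGroup V']
    [Module C V'] : V ≃ₗ[C] LinearMap.ker (LinearMap.snd C V V') where
  toFun v := ⟨(v, 0), rfl⟩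
  map_add' v w := by ext <;> simp
  map_smul' c v := by ext <;> simp
  invFun x := x.1.1
  left_inv v := rfl
  right_inv x := by
    obtain ⟨⟨v, v'⟩, hx⟩ := x
    have hv' : v' = 0 := hx
    subst hv'
    rfl

/-- The sub-Weil–Deligne representation of `r.prod r'` on `V × 0` is isomorphic to `r`. [folklore] -/
def _root_.Literature.NumberTheory.GaloisRepresentations.WeilDeligneRep.prodOfSubrepEquiv
    (r : WeilDeligneRep E C V) (r' : WeilDeligneRep E C V') :
    r.Equiv ((r.prod r').ofSubrep _ (r.isSubrep_prod_kerSnd r')) where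
  toRepEquiv := Representation.Equiv.mk (kerSndEquiv C V V') fun w => by
    refine LinearMap.ext fun v => Subtype.ext ?_
    show ((r.ρ w v, (0 : V')) : V × V') = ((r.ρ w).prodMap (r'.ρ w)) (v, 0)
    rw [LinearMap.prodMap_apply, map_zero]
  comm_N := by
    refine LinearMap.ext fun v => Subtype.ext ?_
    show ((r.N v, (0 : V')) : V × V') = (r.N.prodMap r'.N) (v, 0)
    rw [LinearMap.prodMap_apply, map_zero]

/-- The quotient Weil–Deligne representation of `r.prod r'` by `V × 0` is isomorphic to `r'`
(Mathlib `LinearMap.quotKerEquivOfSurjective` for `snd`). [folklore] -/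
def _root_.Literature.NumberTheory.GaloisRepresentations.WeilDeligneRep.prodToQuotientEquiv
    (r : WeilDeligneRep E C V) (r' : WeilDeligneRep E C V') :
    ((r.prod r').toQuotient _ (r.isSubrep_prod_kerSnd r')).Equiv r' where
  toRepEquiv := Representation.Equiv.mk
      ((LinearMap.snd C V V').quotKerEquivOfSurjective LinearMap.snd_surjective) fun w => by
    refine Submodule.quot_hom_ext _ _ _ fun x => ?_
    obtain ⟨v, v'⟩ := x
    show (LinearMap.snd C V V').quotKerEquivOfSurjective LinearMap.snd_surjective
        (((r.prod r').toQuotient _ (r.isSubrep_prod_kerSnd r')).ρ w (Submodule.Quotient.mk (v, v'))) =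
      r'.ρ w ((LinearMap.snd C V V').quotKerEquivOfSurjective LinearMap.snd_surjective
        (Submodule.Quotient.mk (v, v')))
    rw [toQuotient_ρ_apply_mk, LinearMap.quotKerEquivOfSurjective_apply_mk,
      LinearMap.quotKerEquivOfSurjective_apply_mk]
    rfl
  comm_N := by
    refine Submodule.quot_hom_ext _ _ _ fun x => ?_
    obtain ⟨v, v'⟩ := x
    show (LinearMap.snd C V V').quotKerEquivOfSurjective LinearMap.snd_surjective
        (((r.prod r').toQuotient _ (r.isSubrep_prod_kerSnd r')).N (Submodule.Quotient.mk (v, v'))) =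
      r'.N ((LinearMap.snd C V V').quotKerEquivOfSurjective LinearMap.snd_surjective
        (Submodule.Quotient.mk (v, v')))
    rw [toQuotient_N_apply_mk, LinearMap.quotKerEquivOfSurjective_apply_mk,
      LinearMap.quotKerEquivOfSurjective_apply_mk]
    rfl

end Prod

namespace LocalEpsilonSystem

variable {F : Type} [Field F] [ValuativeRel F] [TopologicalSpace F] [IsNonarchimedeanLocalField F]
variable {E : Type} [Field E] [ValuativeRel E] [TopologicalSpace E] [IsNonarchimedeanLocalField E]
  [Algebra F E] [FiniteDimensional F E] [MeasurableSpace E] [BorelSpace E]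

/-- **`ε₀` is multiplicative on direct sums**: `ε₀(r ⊕ r') = ε₀(r) · ε₀(r')` (Deligne 1973,
Thm. 4.1 (1), the split exact sequence `0 → r → r ⊕ r' → r' → 0`: `mul_subrep` for `V × 0`
with `r.prodOfSubrepEquiv r'`, `r.prodToQuotientEquiv r'`). [cite: Deligne1973, Thm. 4.1] -/
theorem ε₀_prod (𝓔 : LocalEpsilonSystem F) {ψ : AddChar E Circle}
    (hψ : ψ.IsContinuousNontrivial) (μ : Measure E) [μ.IsAddHaarMeasure]
    {V : Type} [AddCommGroup V] [Module ℂ V] [FiniteDimensional ℂ V]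
    {V' : Type} [AddCommGroup V'] [Module ℂ V'] [FiniteDimensional ℂ V']
    (r : GaloisRepresentations.WeilDeligneRep E ℂ V) (r' : GaloisRepresentations.WeilDeligneRep E ℂ V') :
    𝓔.ε₀ E ψ μ (r.prod r') = 𝓔.ε₀ E ψ μ r * 𝓔.ε₀ E ψ μ r' := by
  rw [𝓔.mul_subrep E ψ μ (r.prod r') _ (r.isSubrep_prod_kerSnd r') hψ,
    ← 𝓔.equiv E ψ μ _ _ hψ ⟨r.prodOfSubrepEquiv r'⟩, 𝓔.equiv E ψ μ _ _ hψ ⟨r.prodToQuotientEquiv r'⟩]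

end LocalEpsilonSystem

/-! ### One-dimensional representations of `W_E` are `χ ∘ artin` -/

section DimOne

variable {E : Type*} [Field E] [ValuativeRel E] [TopologicalSpace E] [IsNonarchimedeanLocalField E]

/-- An endomorphism of a one-dimensional space is the homothety of ratio its determinant (kept in
this file's namespace; a local lemma, not a Mathlib extension). [folklore] -/
theorem moduleEnd_eq_det_smul_id_of_finrank_eq_one {V : Type*} [AddCommGroup V] [Module ℂ V]
    (h : finrank ℂ V = 1) (f : V →ₗ[ℂ] V) : f = LinearMap.det f • LinearMap.id := by
  haveI : FiniteDimensional ℂ V := Module.finite_of_finrank_eq_succ h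
  obtain ⟨v, hv, hspan⟩ := finrank_eq_one_iff'.mp h
  obtain ⟨c, hc⟩ := hspan (f v)
  have hf : f = c • LinearMap.id := by
    refine LinearMap.ext fun w => ?_
    obtain ⟨a, rfl⟩ := hspan w
    rw [map_smul, ← hc, LinearMap.smul_apply, LinearMap.id_apply, smul_comm]
  have hdet : LinearMap.det f = c := by
    rw [hf, LinearMap.det_smul, LinearMap.det_id, h, pow_one, mul_one]
  rw [hdet, hf]

variable {V : Type*} [AddCommGroup V] [Module ℂ V]

/-- The **character of a one-dimensional representation** of `W_E`: `w ↦ det ρ(w) ∈ ℂˣ`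
(Mathlib `LinearMap.det`, `MonoidHom.toHomUnits`). Ref: Tate, Corvallis 1979, (2.2). [folklore] -/
def _root_.Literature.NumberTheory.GaloisRepresentations.WeilGroup.detChar
    (ρ : Representation ℂ (GaloisRepresentations.WeilGroup E) V) :
    GaloisRepresentations.WeilGroup E →* ℂˣ :=
  (LinearMap.det.comp ρ).toHomUnits

/-- `detChar ρ w = det ρ(w)`. [folklore] -/
@[simp] theorem _root_.Literature.NumberTheory.GaloisRepresentations.WeilGroup.coe_detChar_apply
    (ρ : Representation ℂ (GaloisRepresentations.WeilGroup E) V) (w : GaloisRepresentations.WeilGroup E) :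
    (detChar ρ w : ℂ) = LinearMap.det (ρ w) := rfl

/-- On a one-dimensional space, `ρ(w) = det ρ(w) · id`. [folklore] -/
theorem _root_.Literature.NumberTheory.GaloisRepresentations.WeilGroup.apply_eq_detChar_smul
    (hV : finrank ℂ V = 1) (ρ : Representation ℂ (GaloisRepresentations.WeilGroup E) V)
    (w : GaloisRepresentations.WeilGroup E) (v : V) : ρ w v = (detChar ρ w : ℂ) • v := by
  conv_lhs => rw [moduleEnd_eq_det_smul_id_of_finrank_eq_one hV (ρ w)]
  rfl

/-- A character of `W_E` trivial on an open subgroup is **continuous** for the Weil topology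
(`W_E` is a topological group, `WeilGroup.isTopologicalGroup_holds`).
Ref: Tate, Corvallis 1979, (1.4.1), (2.2). [folklore] -/
theorem _root_.Literature.NumberTheory.GaloisRepresentations.WeilGroup.continuous_of_forall_mem_eq_one
    (θ : GaloisRepresentations.WeilGroup E →* ℂˣ) {U : Subgroup (GaloisRepresentations.WeilGroup E)}
    (hUo : IsOpen (U : Set (GaloisRepresentations.WeilGroup E))) (hθ : ∀ u ∈ U, θ u = 1) :
    Continuous θ := by
  haveI : IsTopologicalGroup (GaloisRepresentations.WeilGroup E) := isTopologicalGroup_holds E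
  refine continuous_of_continuousAt_one θ (Filter.EventuallyEq.continuousAt (y := (1 : ℂˣ)) ?_)
  exact Filter.eventuallyEq_of_mem (hUo.mem_nhds U.one_mem) fun u hu => hθ u hu

/-- The character of a continuous one-dimensional representation, as a continuous character
`W_E →ₜ* ℂˣ`. Ref: Tate, Corvallis 1979, (2.2). [folklore] -/
def _root_.Literature.NumberTheory.GaloisRepresentations.WeilGroup.detContinuousChar
    (ρ : Representation ℂ (GaloisRepresentations.WeilGroup E) V)
    (hρ : IsContinuousRep ρ) : GaloisRepresentations.WeilGroup E →ₜ* ℂˣ where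
  toMonoidHom := detChar ρ
  continuous_toFun := by
    obtain ⟨U, -, hUo, hU⟩ := hρ
    refine continuous_of_forall_mem_eq_one (detChar ρ) hUo fun u hu => Units.ext ?_
    rw [coe_detChar_apply, hU u hu, Units.val_one]
    exact LinearMap.det_id

/-- `detContinuousChar ρ hρ w = det ρ(w)`. [folklore] -/
@[simp] theorem _root_.Literature.NumberTheory.GaloisRepresentations.WeilGroup.detContinuousChar_apply
    (ρ : Representation ℂ (GaloisRepresentations.WeilGroup E) V)
    (hρ : IsContinuousRep ρ) (w : GaloisRepresentations.WeilGroup E) :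
    detContinuousChar ρ hρ w = detChar ρ w := rfl

/-- **A continuous one-dimensional representation of `W_E` is `χ ∘ artin`** for a continuous
quasi-character `χ` of `Eˣ`, up to isomorphism of Weil–Deligne representations
(`(ρ, 0) ≅ ofQuasiChar d χ`): its character `det ∘ ρ` is continuous and factors through the
local Artin map (`LocalArtinData.recGL1_surjective`, local Langlands for `GL₁`), and two
one-dimensional representations with the same character are isomorphic.
Ref: Tate, Corvallis 1979, (1.4.5), (2.2); Deligne, Antwerp II (1973), §2.3. [cite: Corvallis1979, (2.2)] -/
theorem _root_.Literature.NumberTheory.GaloisRepresentations.WeilDeligneRep.exists_isEquivalent_ofQuasiChar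
    (hns : exists_subgroup_le_inertia_isOpen_of_continuous (F := E))
    (d : GaloisRepresentations.LocalArtinData E) [FiniteDimensional ℂ V] (hV : finrank ℂ V = 1)
    (ρ : Representation ℂ (GaloisRepresentations.WeilGroup E) V) (hρ : IsContinuousRep ρ) :
    ∃ χ : QuasiChar E, (ofRep ρ hρ).IsEquivalent (ofQuasiChar hns d χ) := by
  obtain ⟨χ, hχ⟩ := d.recGL1_surjective (detContinuousChar ρ hρ)
  -- a linear isomorphism `V ≃ ℂ`
  obtain ⟨e⟩ := nonempty_linearEquiv_of_finrank_eq_one hV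
  refine ⟨χ, ⟨{ toRepEquiv := Representation.Equiv.mk e.symm fun w => ?_, comm_N := ?_ }⟩⟩
  · refine LinearMap.ext fun v => ?_
    simp only [LinearMap.coe_comp, LinearEquiv.coe_coe, Function.comp_apply, ofRep_ρ]
    rw [apply_eq_detChar_smul hV ρ w v, map_smul]
    show _ = (ofQuasiChar hns d χ).ρ w (e.symm v)
    rw [ofQuasiChar_ρ_apply, smul_eq_mul, ← GaloisRepresentations.LocalArtinData.recGL1_apply, hχ]
    rfl
  · simp only [ofRep_N, ofQuasiChar_N, LinearMap.comp_zero, LinearMap.zero_comp]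

end DimOne

/-! ### Agreement of two systems on one-dimensional representations -/

namespace LocalEpsilonSystem

variable {F : Type} [Field F] [ValuativeRel F] [TopologicalSpace F] [IsNonarchimedeanLocalField F]
variable {E : Type} [Field E] [ValuativeRel E] [TopologicalSpace E] [IsNonarchimedeanLocalField E]
  [Algebra F E] [FiniteDimensional F E] [MeasurableSpace E] [BorelSpace E]
variable (𝓔 𝓔' : LocalEpsilonSystem F)

/-- **Dimension one, all representations**: two systems of local constants with the same local
Artin data agree on every one-dimensional Weil–Deligne representation of `W_E`, provided Tate's
local constant `ε(s, χ, ψ) = e · q^{-a s}` is witnessed (`HasTateEpsilon`) for every continuous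
quasi-character `χ` of `Eˣ` (Tate 1950, Thm. 2.4.1; the named fact `existsUnique_hasTateEpsilon`):
`(ρ, N) ↦ (ρ, 0) ≅ (χ ∘ artin, 0)` (`exists_isEquivalent_ofQuasiChar`) and `dim_one`.
[cite: Deligne1973, Thm. 4.1] -/
theorem ε₀_eq_of_finrank_eq_one (hart : 𝓔.artin = 𝓔'.artin)
    (hns : exists_subgroup_le_inertia_isOpen_of_continuous (F := E))
    {ψ : AddChar E Circle} (hψ : ψ.IsContinuousNontrivial) (μ : Measure E) [μ.IsAddHaarMeasure]
    (hT : ∀ χ : QuasiChar E, ∃ (μ' : Measure Eˣ) (_ : μ'.IsHaarMeasure) (e : ℂ) (a : ℤ),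
      HasTateEpsilon ψ μ μ' χ e a)
    {V : Type} [AddCommGroup V] [Module ℂ V] [FiniteDimensional ℂ V] (hV : finrank ℂ V = 1)
    (r : GaloisRepresentations.WeilDeligneRep E ℂ V) : 𝓔.ε₀ E ψ μ r = 𝓔'.ε₀ E ψ μ r := by
  rw [𝓔.indep_N E ψ μ r (ofRep r.ρ r.isContinuous) hψ rfl,
    𝓔'.indep_N E ψ μ r (ofRep r.ρ r.isContinuous) hψ rfl]
  obtain ⟨χ, hχ⟩ := exists_isEquivalent_ofQuasiChar hns (𝓔.artin E) hV r.ρ r.isContinuous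
  rw [𝓔.equiv E ψ μ _ _ hψ hχ, 𝓔'.equiv E ψ μ _ _ hψ hχ]
  obtain ⟨μ', _, e, a, he⟩ := hT χ
  rw [𝓔.dim_one E hns ψ μ χ μ' e a hψ he, hart, 𝓔'.dim_one E hns ψ μ χ μ' e a hψ he]

end LocalEpsilonSystem

end PartII

end Literature.NumberTheory.Automorphic

end
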